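import Literature.AlgebraicGeometry.Frobenioids.Prop53SubProofs
import Literature.AlgebraicGeometry.Frobenioids.Prop53SubRlfHolds
import Literature.AlgebraicGeometry.Frobenioids.Prop53SubPullbacksReflectHolds
import Literature.AlgebraicGeometry.Frobenioids.ArithmeticFrobenioidHypotheses
import Literature.AlgebraicGeometry.Frobenioids.ArithmeticFrobenioidRealificationDivSlim
import Literature.AlgebraicGeometry.Frobenioids.FinSubextCatFSM
import Literature.AlgebraicGeometry.Frobenioids.GeometricFrobenioidNonDilating
import HarnessLib

/-!
# Frobenioids I, Proposition 5.3: THE realification `C^rlf` IS a Frobenioid (of isotropic type) — row P53/L02 CLOSED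
# at THE data, with the arithmetic (Ex. 6.3) and geometric (Ex. 6.1) instances

Mochizuki, *The geometry of Frobenioids I: the general theory*, Kyushu J. Math. **62** (2008) 293–400,
Proposition 5.3, kurims p. 103 l. 9–12: "Then we shall refer to as the *realification* of the Frobenioid `C` the
model Frobenioid [cf. Theorem 5.2, (ii)] `C^rlf` associated to the divisor monoid `Φ^rlf` [i.e., the
'realification' of Definition 2.4, (i)] on `D` and the rational function monoid `ℝ · Φ^birat ⊆ (Φ^rlf)^gp`";
Theorem 5.2 (ii) p. 101: "`C` is a Frobenioid of … isotropic … type"; Ex. 6.3 p. 113 / Thm. 6.4 (i) p. 115 and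
Ex. 6.1 p. 109 / Thm. 6.2 for the two motivating divisor monoids. [cite: MochizukiFrdI2008, Prop. 5.3 p.103]

PROOF-ONLY companion (cell abc-iut, L1 sub-DAG W3 = [FrdI] Prop. 5.3 + Cor. 5.4, seat abc-iut-w5-d137, row
**P53/L02 = (H)** of `Prop53Sub.lean`). The statements file proved the COMPOSITION
`FrdI.Prop53Sub.rlfHypotheses_of` — the hypotheses `ModelFrobenioid.Hypotheses (Φ^rlf) (ℝ · Φ^birat)` of
Thm. 5.2 at THE realified data follow from "`Φ` is a monoid on `D` whose pull-backs reflect divisibility, `D` is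
connected and totally epimorphic" plus the five named rows P53/L02a (`IsMonoidOnRlf`), L02b (`RlfDivisorial`),
L02c (`IsMonoidOnRealSpan`), L02c′ (`RealSpanGroupLike`), L02d (`BiratFSMSurjective`). All five rows are now
LANDED (`isMonoidOnRlf_holds`, `isMonoidOnRealSpan_holds`, `GpSubfunctor.isFSMSurjective_of_isIso` in
`Prop53SubProofs.lean`, seat abc-iut-w5-d137; `rlfDivisorial_holds`, `realSpanGroupLike_holds` in
`Prop53SubRlfHolds.lean`, seat abc-iut-L1-d2), so here:
* `FrdI.Prop53Sub.rlfHypotheses_holds` — (H) from print's standing hypotheses and the one INPUT-shaped row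
  L02d (`BiratFSMSurjective F`: `Φ^birat` has surjective pull-backs along FSM-morphisms);
* `FrdI.Prop53Sub.biratFSMSurjective_of_isOfFSMType` — L02d is AUTOMATIC over a base category of FSM-type
  (every FSM-morphism an isomorphism, §0 p. 14), the case of every base of §6 and of [IUTchI];
* **`FrdI.Prop53Sub.rlf_isFrobenioid_of_isOfFSMType`**: for a perf-factorial monoid `Φ` on a connected, totally
  epimorphic category `D` of FSM-type whose pull-backs reflect divisibility, and ANY pre-Frobenioid structure
  `F : C → F_Φ`, THE realification `C^rlf → F_{Φ^rlf}` (`PreFrobenioid.rlfToElem F hΦ`, seat abc-iut-L1-d2) IS A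
  FROBENIOID, OF ISOTROPIC TYPE — Thm. 5.2 (ii) (`ModelFrobenioid.isFrobenioid`, seat abc-iut-found) at THE data;
* INSTANCES: `arithFrobenioid_rlf_isFrobenioid` — THE realification of the arithmetic Frobenioid `C_{K/F}` of a
  Galois extension of number fields (Ex. 6.3; inputs `arithDivisorFunctor_isMonoidOn`, `pullbacksReflectDvd_arith`,
  `FinSubextCat.isGraphConnected / isTotallyEpimorphic / isOfFSMType`, `arithDivisorFunctor_isPerfFactorial`, seats
  abc-iut-L6-t10 / abc-iut-L1-d2), and `geomFrobenioid_rlf_isFrobenioid` — THE realification of the geometric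
  Frobenioid of Ex. 6.1 (for any perf-factoriality witness of its divisor monoid).
This discharges, at those data, the named hypothesis `hR : IsFrobenioid (rlfToElem F hΦ)` carried by the Prop. 5.5
sub-DAG (`Prop55Sub.lean`, seat abc-iut-w4-d084). No definitions, no new `Prop`-valued fact; [FrdI] is a refereed
preparatory paper — nothing here bears on [IUTchIII] Cor. 3.12 or asserts anything about abc.
-/

noncomputable section

namespace Literature.AlgebraicGeometry.Frobenioids

open CategoryTheory Opposite Function Literature.AnabelianGeometry.EtaleTheta

universe w v v' u u'

/-! ### Row P53/L02 = (H) at THE data -/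

namespace FrdI.Prop53Sub

variable {D : Type u} [Category.{v} D] {Φ : Dᵒᵖ ⥤ CommMonCat.{w}}
  {C : Type u'} [Category.{v'} C] (F : C ⥤ ElemFrobenioid Φ)

/-- **Row P53/L02 = (H), CLOSED modulo the input-shaped row L02d**: for a perf-factorial monoid `Φ` on `D` whose
pull-backs reflect divisibility, `D` connected and totally epimorphic, and `Φ^birat` FSM-surjective, the realified
data `(Φ^rlf, ℝ · Φ^birat)` satisfy the hypotheses of Thm. 5.2 (`RlfHypotheses F hΦ`) — the composition
`rlfHypotheses_of` fed with the LANDED rows L02a/L02b/L02c/L02c′. [cite: MochizukiFrdI2008, Prop. 5.3 p.103] -/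
theorem rlfHypotheses_holds (hΦ : PreFrobenioid.IsPerfFactorialOn Φ) (hM : IsMonoidOn Φ)
    (hrefl : PullbacksReflectDvd Φ) (hDc : IsGraphConnected D) (hDe : IsTotallyEpimorphic D)
    (h02d : BiratFSMSurjective F) : RlfHypotheses F hΦ :=
  rlfHypotheses_of F hΦ hM hrefl hDc hDe (isMonoidOnRlf_holds _) (rlfDivisorial_holds _)
    (isMonoidOnRealSpan_holds _ _) (realSpanGroupLike_holds _ _) h02d

/-- **Row P53/L02d over a base of FSM-type**: if every FSM-morphism of `D` is an isomorphism (§0 p. 14, "of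
FSM-type"), the rational-function subfunctor `Φ^birat = biratSubfunctor F` has surjective pull-backs along
FSM-morphisms (`GpSubfunctor.isFSMSurjective_of_isIso`). [cite: MochizukiFrdI2008, Prop. 5.3 p.103] -/
theorem biratFSMSurjective_of_isOfFSMType (hD : IsOfFSMType D) : BiratFSMSurjective F :=
  GpSubfunctor.isFSMSurjective_of_isIso _ (fun _ _ α hα => hD.isIso_of_isFSM α hα)

/-- **(H) over a base of FSM-type, no input-shaped hypothesis left**: `Φ` a perf-factorial monoid on `D` with
divisibility-reflecting pull-backs, `D` connected, totally epimorphic, of FSM-type ⟹ `RlfHypotheses F hΦ`.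
[cite: MochizukiFrdI2008, Prop. 5.3 p.103] -/
theorem rlfHypotheses_holds_of_isOfFSMType (hΦ : PreFrobenioid.IsPerfFactorialOn Φ) (hM : IsMonoidOn Φ)
    (hrefl : PullbacksReflectDvd Φ) (hDc : IsGraphConnected D) (hDe : IsTotallyEpimorphic D)
    (hD : IsOfFSMType D) : RlfHypotheses F hΦ :=
  rlfHypotheses_holds F hΦ hM hrefl hDc hDe (biratFSMSurjective_of_isOfFSMType F hD)

/-- **Prop. 5.3, "the model Frobenioid [cf. Theorem 5.2, (ii)] `C^rlf`" — THE realification IS a Frobenioid, of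
isotropic type** (general form, L02d as a named input). [cite: MochizukiFrdI2008, Prop. 5.3 p.103] -/
theorem rlf_isFrobenioid (hΦ : PreFrobenioid.IsPerfFactorialOn Φ) (hM : IsMonoidOn Φ)
    (hrefl : PullbacksReflectDvd Φ) (hDc : IsGraphConnected D) (hDe : IsTotallyEpimorphic D)
    (h02d : BiratFSMSurjective F) :
    PreFrobenioid.IsFrobenioid (PreFrobenioid.rlfToElem F hΦ) ∧
      PreFrobenioid.IsOfIsotropicType (PreFrobenioid.rlfToElem F hΦ) :=
  rlf_isFrobenioid_of_hypotheses F hΦ (rlfHypotheses_holds F hΦ hM hrefl hDc hDe h02d)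

/-- **Prop. 5.3 over a base of FSM-type: THE realification `C^rlf → F_{Φ^rlf}` IS a Frobenioid, of isotropic type**
— for a perf-factorial monoid `Φ` on a connected, totally epimorphic category `D` of FSM-type whose pull-backs
reflect divisibility, and any pre-Frobenioid structure `F : C → F_Φ`. [cite: MochizukiFrdI2008, Prop. 5.3 p.103] -/
theorem rlf_isFrobenioid_of_isOfFSMType (hΦ : PreFrobenioid.IsPerfFactorialOn Φ) (hM : IsMonoidOn Φ)
    (hrefl : PullbacksReflectDvd Φ) (hDc : IsGraphConnected D) (hDe : IsTotallyEpimorphic D)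
    (hD : IsOfFSMType D) :
    PreFrobenioid.IsFrobenioid (PreFrobenioid.rlfToElem F hΦ) ∧
      PreFrobenioid.IsOfIsotropicType (PreFrobenioid.rlfToElem F hΦ) :=
  rlf_isFrobenioid_of_hypotheses F hΦ (rlfHypotheses_holds_of_isOfFSMType F hΦ hM hrefl hDc hDe hD)

end FrdI.Prop53Sub

/-! ### Instance: THE realification of the arithmetic Frobenioid `C_{K/F}` (Ex. 6.3 / Thm. 6.4 (i)) -/

section Arith

variable (F : Type) [Field F] [NumberField F] (K : Type) [Field K] [Algebra F K] [IsGalois F K]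

omit [IsGalois F K] in
/-- The arithmetic divisor monoid `Φ : Spec L ↦ Φ(L)` of Ex. 6.3 is perf-factorial on `D` (objectwise form of
`arithDivisorFunctor_isPerfFactorial`). [cite: MochizukiFrdI2008, Ex. 6.3 p.113] -/
theorem arithDivisorFunctor_isPerfFactorialOn : PreFrobenioid.IsPerfFactorialOn (arithDivisorFunctor F K) :=
  fun X => arithDivisorFunctor_isPerfFactorial F K (op X)

/-- **The hypotheses of Thm. 5.2 for the REALIFIED arithmetic data** `(Φ^rlf, ℝ · Φ^birat)` of `C_{K/F}` (`K/F` a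
Galois extension of number fields; Ex. 6.3 p. 113 "`Φ`, `B` determine monoids on `D`", Thm. 6.4 (i) p. 115):
`RlfHypotheses` at THE arithmetic Frobenioid. [cite: MochizukiFrdI2008, Thm. 6.4 (i) p.115] -/
theorem arithFrobenioid_rlfHypotheses :
    FrdI.Prop53Sub.RlfHypotheses
      (ModelFrobenioid.toElem (arithDivisorFunctor F K) (unitsFunctor F K) (divNatTrans F K))
      (arithDivisorFunctor_isPerfFactorialOn F K) :=
  FrdI.Prop53Sub.rlfHypotheses_holds_of_isOfFSMType _ _ (arithDivisorFunctor_isMonoidOn F K)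
    (pullbacksReflectDvd_arith F K) (FinSubextCat.isGraphConnected F K) (FinSubextCat.isTotallyEpimorphic F K)
    (FinSubextCat.isOfFSMType F K)

/-- **THE realification `C_{K/F}^rlf` of the arithmetic Frobenioid of a Galois extension of number fields IS a
Frobenioid, of isotropic type** (Prop. 5.3 at the data of Ex. 6.3; cf. Thm. 6.4 (i) "`C^rlf` [is] of isotropic and
rationally standard type"). [cite: MochizukiFrdI2008, Thm. 6.4 (i) p.115] -/
theorem arithFrobenioid_rlf_isFrobenioid :
    PreFrobenioid.IsFrobenioid
        (PreFrobenioid.rlfToElem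
          (ModelFrobenioid.toElem (arithDivisorFunctor F K) (unitsFunctor F K) (divNatTrans F K))
          (arithDivisorFunctor_isPerfFactorialOn F K)) ∧
      PreFrobenioid.IsOfIsotropicType
        (PreFrobenioid.rlfToElem
          (ModelFrobenioid.toElem (arithDivisorFunctor F K) (unitsFunctor F K) (divNatTrans F K))
          (arithDivisorFunctor_isPerfFactorialOn F K)) :=
  FrdI.Prop53Sub.rlf_isFrobenioid_of_hypotheses _ _ (arithFrobenioid_rlfHypotheses F K)

end Arith

/-! ### Instance: THE realification of the geometric Frobenioid (Ex. 6.1 / Thm. 6.2) -/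

section Geom

variable {K : Type} [Field K] {Kt : Type} [Field Kt] [Algebra K Kt] [IsGalois K Kt] (Γ : GeometricDivisorData K Kt)

/-- **The hypotheses of Thm. 5.2 for the REALIFIED geometric data** `(Φ^rlf, ℝ · Φ^birat)` of the geometric
Frobenioid of Ex. 6.1 (`K̃/K` Galois), for any perf-factoriality witness `hΦ` of its divisor monoid.
[cite: MochizukiFrdI2008, Ex. 6.1 p.109] -/
theorem geomFrobenioid_rlfHypotheses (hΦ : PreFrobenioid.IsPerfFactorialOn (geomDivisorFunctor Γ)) :
    FrdI.Prop53Sub.RlfHypotheses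
      (ModelFrobenioid.toElem (geomDivisorFunctor Γ) (geomUnitsFunctor Γ) (geomDivNatTrans Γ)) hΦ :=
  FrdI.Prop53Sub.rlfHypotheses_holds_of_isOfFSMType _ _ (geomDivisorFunctor_isMonoidOn Γ)
    (pullbacksReflectDvd_geom Γ) (FinSubextCat.isGraphConnected K Kt) (FinSubextCat.isTotallyEpimorphic K Kt)
    (FinSubextCat.isOfFSMType K Kt)

/-- **THE realification of the geometric Frobenioid of Ex. 6.1 IS a Frobenioid, of isotropic type** (Prop. 5.3 at
the data of Ex. 6.1, `K̃/K` Galois), for any perf-factoriality witness `hΦ` of the geometric divisor monoid.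
[cite: MochizukiFrdI2008, Ex. 6.1 p.109] -/
theorem geomFrobenioid_rlf_isFrobenioid (hΦ : PreFrobenioid.IsPerfFactorialOn (geomDivisorFunctor Γ)) :
    PreFrobenioid.IsFrobenioid
        (PreFrobenioid.rlfToElem
          (ModelFrobenioid.toElem (geomDivisorFunctor Γ) (geomUnitsFunctor Γ) (geomDivNatTrans Γ)) hΦ) ∧
      PreFrobenioid.IsOfIsotropicType
        (PreFrobenioid.rlfToElem
          (ModelFrobenioid.toElem (geomDivisorFunctor Γ) (geomUnitsFunctor Γ) (geomDivNatTrans Γ)) hΦ) :=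
  FrdI.Prop53Sub.rlf_isFrobenioid_of_hypotheses _ _ (geomFrobenioid_rlfHypotheses Γ hΦ)

end Geom

end Literature.AlgebraicGeometry.Frobenioids

end
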